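import Literature.NumberTheory.EllipticCurves.IsogenyHomProofs
import HarnessLib

/-!
# Composition of isogenies: proofs of `Isogeny.nonempty_comp` and `IsIsogenous.trans`

Sibling file of `Literature.NumberTheory.EllipticCurves.Isogeny` (D-0014 append protocol). It
constructs the composite `ψ ∘ φ : E → E''` of two isogenies `φ : E → E'`, `ψ : E' → E''` over `K`
(Silverman, *The Arithmetic of Elliptic Curves*, III.4: "Isogenies are closed under composition";
the relation of isogeny is transitive, III.6) as a term of the prelude structure
`WeierstrassCurve.Isogeny W W''` — the composite homomorphism of `K̄`-points, algebraic through
the *substituted* rational map (the formulae of `ψ` with the formulae of `φ` plugged in and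
denominators cleared, `WeierstrassCurve.substClear`) off the finite set
`S_φ ∪ φ⁻¹(S_ψ)`, `Γ_K`-equivariant, with finite kernel — and discharges with it the two named
facts of `Isogeny.lean`

* `WeierstrassCurve.Isogeny.nonempty_comp` (`Isogeny.nonempty_comp_holds`), and
* `WeierstrassCurve.IsIsogenous.trans` (`IsIsogenous.trans_holds`),

for Weierstrass curves over any field `K` (no `IsElliptic` hypothesis is used).

## Contents

* `WeierstrassCurve.substClear F P₁ Q₁ P₂ Q₂ d`: the polynomial
  `Q₁^d Q₂^d · F(P₁/Q₁, P₂/Q₂)` (for `d` bounding the exponents of `F`), with its evaluation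
  formula `eval_substClear`.
* `WeierstrassCurve.Isogeny.isAlgebraicOn_comp`: `ψ ∘ φ` agrees with the substituted rational
  map at every point where `φ` agrees with its formulae and `ψ` agrees with its formulae at `φ P`;
  the exceptional set is contained in `S_φ ∪ φ⁻¹(S_ψ)`, finite because the fibres of `φ` are
  translates of its finite kernel.
* `WeierstrassCurve.Isogeny.comp ψ φ : Isogeny W W''`, with `Isogeny.comp_apply` (`simp`).
* `WeierstrassCurve.Isogeny.nonempty_comp_holds`, `WeierstrassCurve.IsIsogenous.trans_holds`.

Mathlib has no isogenies (the prelude `Isogeny.lean` records this); the coordinate function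
`geomPoints.xy`, `agreesWithRationalMapAt_iff` and `IsAlgebraicOn.finite_ker` are the tree's
(`IsogenyHomProofs.lean`, which treats sums and negatives of isogenies; composition is not
there: `lean search` for `Isogeny.comp`, `nonempty_comp_holds`, `trans_holds` in
`Literature/NumberTheory/EllipticCurves` found nothing).

## References

* J. H. Silverman, *The Arithmetic of Elliptic Curves*, 2nd ed., GTM 106 (2009), I.3 (rational
  maps and their composition), III.4 (isogenies; composition of isogenies, `Hom` and `End`),
  III.6 (isogeny as an equivalence relation).
-/

noncomputable section

open scoped Classical

universe u

namespace WeierstrassCurve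

open MvPolynomial geomPoints

/-! ## Substituting a rational map into a polynomial -/

section Subst

variable {L : Type*} [Field L]

/-- `substClear F P₁ Q₁ P₂ Q₂ d = Q₁^d Q₂^d · F(P₁/Q₁, P₂/Q₂)`, written out as the polynomial
`∑_{(i,j)} c_{ij} P₁^i Q₁^{d-i} P₂^j Q₂^{d-j}` over the monomials `c_{ij} xⁱ yʲ` of `F`; it is
the numerator (or denominator) of a composite of rational maps in two variables once `d` bounds
the exponents of `F` (`eval_substClear`). Silverman, *AEC*, I.3 (composition of rational maps).
[folklore] -/
def substClear (F P₁ Q₁ P₂ Q₂ : MvPolynomial (Fin 2) L) (d : ℕ) : MvPolynomial (Fin 2) L :=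
  ∑ m ∈ F.support, C (coeff m F) * (P₁ ^ (m 0) * Q₁ ^ (d - m 0)) * (P₂ ^ (m 1) * Q₂ ^ (d - m 1))

/-- The exponents of a monomial of `F` are bounded by the total degree of `F`. [folklore] -/
theorem apply_le_totalDegree_of_mem_support {F : MvPolynomial (Fin 2) L} {m : Fin 2 →₀ ℕ}
    (hm : m ∈ F.support) (i : Fin 2) : m i ≤ F.totalDegree :=
  (monomial_le_degreeOf i hm).trans (degreeOf_le_totalDegree F i)

/-- **Evaluation of the substituted polynomial.** If `d` bounds the exponents of `F` and
`Q₁(v), Q₂(v) ≠ 0`, then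
`substClear F P₁ Q₁ P₂ Q₂ d (v) = Q₁(v)^d Q₂(v)^d · F(P₁(v)/Q₁(v), P₂(v)/Q₂(v))`.
Silverman, *AEC*, I.3. [folklore] -/
theorem eval_substClear {F P₁ Q₁ P₂ Q₂ : MvPolynomial (Fin 2) L} {d : ℕ}
    (hd : ∀ m ∈ F.support, m 0 ≤ d ∧ m 1 ≤ d) {v : Fin 2 → L}
    (h₁ : eval v Q₁ ≠ 0) (h₂ : eval v Q₂ ≠ 0) :
    eval v (substClear F P₁ Q₁ P₂ Q₂ d) =
      eval v Q₁ ^ d * eval v Q₂ ^ d *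
        eval ![eval v P₁ / eval v Q₁, eval v P₂ / eval v Q₂] F := by
  rw [substClear, eval_sum, eval_eq' _ F, Finset.mul_sum]
  refine Finset.sum_congr rfl fun m hm => ?_
  obtain ⟨h0, h1⟩ := hd m hm
  simp only [map_mul, map_pow, eval_C, Fin.prod_univ_two, Matrix.cons_val_zero,
    Matrix.cons_val_one]
  have e1 : eval v Q₁ ^ d = eval v Q₁ ^ (m 0) * eval v Q₁ ^ (d - m 0) := by
    rw [← pow_add, Nat.add_sub_cancel' h0]
  have e2 : eval v Q₂ ^ d = eval v Q₂ ^ (m 1) * eval v Q₂ ^ (d - m 1) := by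
    rw [← pow_add, Nat.add_sub_cancel' h1]
  rw [e1, e2, div_pow, div_pow]
  field_simp

end Subst

/-! ## Composition of isogenies -/

variable {K : Type u} [Field K] {W W' W'' : WeierstrassCurve K}

/-- The fibres of a homomorphism of abelian groups with finite kernel are finite (a non-empty
fibre is a translate of the kernel). (The same elementary lemma is proved in
`ComplexMultiplication.lean`, which is deliberately not imported into this light file.)
[folklore] -/
private theorem finite_preimage_singleton {A B : Type*} [AddCommGroup A] [AddCommGroup B]
    (f : A →+ B) (hker : (f.ker : Set A).Finite) (b : B) : (f ⁻¹' {b}).Finite := by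
  by_cases hb : ∃ a, f a = b
  · obtain ⟨a, rfl⟩ := hb
    refine (hker.image fun k => a + k).subset ?_
    intro x hx
    refine ⟨x - a, ?_, by abel⟩
    rw [Set.mem_preimage, Set.mem_singleton_iff] at hx
    simp [AddMonoidHom.mem_ker, map_sub, hx]
  · push Not at hb
    convert Set.finite_empty
    ext x
    simpa using hb x

/-- A sufficient condition for `AgreesWithRationalMapAt`, with the coordinates of the value
given up to provable equalities (avoids dependent rewriting). [folklore] -/
theorem agreesWithRationalMapAt_of_eq {P₁ Q₁ P₂ Q₂ : MvPolynomial (Fin 2) (AlgebraicClosure K)}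
    {f : W.geomPoints → W'.geomPoints} {P : W.geomPoints} (hP : P ≠ 0)
    (hQ₁ : eval (xy P) Q₁ ≠ 0) (hQ₂ : eval (xy P) Q₂ ≠ 0) {a b : AlgebraicClosure K}
    (h : (W'.baseChange (AlgebraicClosure K)).toAffine.Nonsingular a b)
    (hf : f P = (Affine.Point.some a b h : W'.geomPoints))
    (ha : a = eval (xy P) P₁ / eval (xy P) Q₁) (hb : b = eval (xy P) P₂ / eval (xy P) Q₂) :
    AgreesWithRationalMapAt W W' P₁ Q₁ P₂ Q₂ f P := by
  subst ha hb
  exact agreesWithRationalMapAt_iff.2 ⟨hP, hQ₁, hQ₂, h, hf⟩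

namespace Isogeny

/-- **The composite of two isogenies is algebraic.** If `φ : E → E'` agrees with
`(P₁/Q₁, P₂/Q₂)` off the finite set `S_φ` and `ψ : E' → E''` agrees with `(P₁'/Q₁', P₂'/Q₂')`
off the finite set `S_ψ`, then `ψ ∘ φ` agrees with the substituted formulae
`(P₁'(P₁/Q₁, P₂/Q₂)/Q₁'(P₁/Q₁, P₂/Q₂), P₂'(…)/Q₂'(…))`, denominators cleared by `substClear`,
off `S_φ ∪ φ⁻¹(S_ψ)`, which is finite since the fibres of `φ` are finite.
Silverman, *AEC*, I.3 and III.4 (composition of isogenies). [folklore] -/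
theorem isAlgebraicOn_comp (ψ : Isogeny W' W'') (φ : Isogeny W W') :
    IsAlgebraicOn W W'' (fun P => ψ (φ P)) := by
  obtain ⟨P₁, Q₁, P₂, Q₂, hS⟩ := φ.isAlgebraic
  obtain ⟨P₁', Q₁', P₂', Q₂', hS'⟩ := ψ.isAlgebraic
  -- common exponent bounds for the `x`- and `y`-formulae of `ψ`
  set d₁ := P₁'.totalDegree + Q₁'.totalDegree with hd₁
  set d₂ := P₂'.totalDegree + Q₂'.totalDegree with hd₂
  have hdP₁ : ∀ m ∈ P₁'.support, m 0 ≤ d₁ ∧ m 1 ≤ d₁ := fun m hm =>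
    ⟨(apply_le_totalDegree_of_mem_support hm 0).trans (Nat.le_add_right _ _),
      (apply_le_totalDegree_of_mem_support hm 1).trans (Nat.le_add_right _ _)⟩
  have hdQ₁ : ∀ m ∈ Q₁'.support, m 0 ≤ d₁ ∧ m 1 ≤ d₁ := fun m hm =>
    ⟨(apply_le_totalDegree_of_mem_support hm 0).trans (Nat.le_add_left _ _),
      (apply_le_totalDegree_of_mem_support hm 1).trans (Nat.le_add_left _ _)⟩
  have hdP₂ : ∀ m ∈ P₂'.support, m 0 ≤ d₂ ∧ m 1 ≤ d₂ := fun m hm =>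
    ⟨(apply_le_totalDegree_of_mem_support hm 0).trans (Nat.le_add_right _ _),
      (apply_le_totalDegree_of_mem_support hm 1).trans (Nat.le_add_right _ _)⟩
  have hdQ₂ : ∀ m ∈ Q₂'.support, m 0 ≤ d₂ ∧ m 1 ≤ d₂ := fun m hm =>
    ⟨(apply_le_totalDegree_of_mem_support hm 0).trans (Nat.le_add_left _ _),
      (apply_le_totalDegree_of_mem_support hm 1).trans (Nat.le_add_left _ _)⟩
  refine ⟨substClear P₁' P₁ Q₁ P₂ Q₂ d₁, substClear Q₁' P₁ Q₁ P₂ Q₂ d₁,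
    substClear P₂' P₁ Q₁ P₂ Q₂ d₂, substClear Q₂' P₁ Q₁ P₂ Q₂ d₂, ?_⟩
  -- the exceptional set is contained in `S_φ ∪ φ⁻¹(S_ψ)`
  refine (hS.union (hS'.preimage' fun Q _ =>
    finite_preimage_singleton φ.toAddMonoidHom φ.finite_ker Q)).subset ?_
  intro P hP
  by_contra hmem
  simp only [Set.mem_union, Set.mem_setOf_eq, Set.mem_preimage, not_or, not_not,
    coe_toAddMonoidHom] at hmem
  obtain ⟨hφP, hψP⟩ := hmem
  apply hP
  obtain ⟨hP0, hQ₁, hQ₂, h', hφ⟩ := agreesWithRationalMapAt_iff.1 hφP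
  obtain ⟨-, hQ₁', hQ₂', h'', hψ⟩ := agreesWithRationalMapAt_iff.1 hψP
  -- the coordinates of `φ P`
  have hw : xy (φ P) = ![eval (xy P) P₁ / eval (xy P) Q₁, eval (xy P) P₂ / eval (xy P) Q₂] := by
    rw [hφ, xy_some]
  have hc₁ : eval (xy P) Q₁ ^ d₁ * eval (xy P) Q₂ ^ d₁ ≠ 0 :=
    mul_ne_zero (pow_ne_zero _ hQ₁) (pow_ne_zero _ hQ₂)
  have hc₂ : eval (xy P) Q₁ ^ d₂ * eval (xy P) Q₂ ^ d₂ ≠ 0 :=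
    mul_ne_zero (pow_ne_zero _ hQ₁) (pow_ne_zero _ hQ₂)
  refine agreesWithRationalMapAt_of_eq hP0 ?_ ?_ h'' hψ ?_ ?_
  · rw [eval_substClear hdQ₁ hQ₁ hQ₂, ← hw]
    exact mul_ne_zero hc₁ hQ₁'
  · rw [eval_substClear hdQ₂ hQ₁ hQ₂, ← hw]
    exact mul_ne_zero hc₂ hQ₂'
  · rw [eval_substClear hdP₁ hQ₁ hQ₂, eval_substClear hdQ₁ hQ₁ hQ₂, ← hw,
      mul_div_mul_left _ _ hc₁]
  · rw [eval_substClear hdP₂ hQ₁ hQ₂, eval_substClear hdQ₂ hQ₁ hQ₂, ← hw,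
      mul_div_mul_left _ _ hc₂]

/-- **The composite isogeny** `ψ ∘ φ : E → E''` of isogenies `φ : E → E'` and `ψ : E' → E''`
over `K` (Silverman, *AEC*, III.4), as a term of the prelude's `Isogeny W W''`: the composite
homomorphism on `K̄`-points, algebraic by `isAlgebraicOn_comp`, `Γ_K`-equivariant, and with
finite kernel (an algebraic additive map has finite kernel, `IsAlgebraicOn.finite_ker`; also
directly `ker (ψ ∘ φ) = φ⁻¹(ker ψ)`). [cite: SilvermanAEC2009, III.4] -/
def comp (ψ : Isogeny W' W'') (φ : Isogeny W W') : Isogeny W W'' where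
  toAddMonoidHom := ψ.toAddMonoidHom.comp φ.toAddMonoidHom
  isAlgebraic := isAlgebraicOn_comp ψ φ
  equivariant σ P := by
    simp only [AddMonoidHom.coe_comp, Function.comp_apply, coe_toAddMonoidHom, map_smul]
  finite_ker := IsAlgebraicOn.finite_ker (isAlgebraicOn_comp ψ φ)

/-- The composite isogeny acts as the composite on `E(K̄)`. Silverman, *AEC*, III.4.
[folklore] -/
@[simp]
theorem comp_apply (ψ : Isogeny W' W'') (φ : Isogeny W W') (P : W.geomPoints) :
    ψ.comp φ P = ψ (φ P) :=
  rfl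

/-- The kernel of the composite is the preimage of the kernel. Silverman, *AEC*, III.4.
[folklore] -/
theorem ker_comp (ψ : Isogeny W' W'') (φ : Isogeny W W') :
    (ψ.comp φ).toAddMonoidHom.ker = ψ.toAddMonoidHom.ker.comap φ.toAddMonoidHom :=
  rfl

variable (W W') in
/-- **Discharge of the named fact `WeierstrassCurve.Isogeny.nonempty_comp`** (`Isogeny.lean`):
the composite of two isogenies is an isogeny. Silverman, *AEC*, III.4.
[cite: SilvermanAEC2009, III.4] -/
theorem nonempty_comp_holds : Isogeny.nonempty_comp (W := W) (W' := W') :=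
  fun ψ φ => ⟨ψ.comp φ, fun _ => rfl⟩

end Isogeny

variable (W W' W'') in
/-- **Discharge of the named fact `WeierstrassCurve.IsIsogenous.trans`** (`Isogeny.lean`):
isogeny over `K` is transitive. Silverman, *AEC*, III.4 and III.6 (isogeny is an equivalence
relation). [cite: SilvermanAEC2009, III.4] -/
theorem IsIsogenous.trans_holds : IsIsogenous.trans (W := W) (W' := W') (W'' := W'') :=
  fun h h' => h.elim fun φ => h'.elim fun ψ => ⟨ψ.comp φ⟩

/-- Transitivity of `IsIsogenous` as a plain implication. Silverman, *AEC*, III.4. [folklore] -/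
theorem IsIsogenous.trans' (h : IsIsogenous W W') (h' : IsIsogenous W' W'') : IsIsogenous W W'' :=
  IsIsogenous.trans_holds W W' W'' h h'

end WeierstrassCurve

end
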